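/-
Copyright: seat `ym-line-cbag-p2` (prover-ym-line-cbag-p2-g0-0), route `ColdBoxAllGroups`, crux `BulkAllGroups`
(stmt-QuantumFields-22255), line `dlr-chessboard-G` (skeleton `Cruxes/BulkAllGroups/Lines/birth.lean`, v4).
-/
import Summits.QuantumFields.YangMills.Theorems.ColdBoxAllGroupsBoxFloorAllGroupsStubBoxDirichletDominationAbsG
import Summits.QuantumFields.YangMills.Theorems.ColdBoxAllGroupsBoxFloorAllGroupsLargeFieldG

/-!
# Registered stub FLAT-ABS-G `stub_boxDirichletAbsG` of crux `BulkAllGroups` (stmt-QuantumFields-22255), BY NAME — the absolute one-scale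
# comparison of the cold-wall box with its temporal-gauge Dirichlet Gaussian, every compact simple `G`, from the sibling crux's PROVED S2

The sibling line (crux `BoxFloorAllGroups`, stmt-QuantumFields-22254, PROVED) landed S2 `stub_boxDirichletDominationAbsG` (hypothesis S1 =
`stub_boxLargeFieldRarityG`, landed) at the crux's instance `borel G`.  The BULK line registered the same conclusion in instance-binder form
(`∀ [MeasurableSpace G] [BorelSpace G]`); since `BorelSpace G` forces `‹MeasurableSpace G› = borel G`, the registered form follows by `subst`.
NOT a claim about the mass gap; the Yang–Mills mass gap is NOT proved by any of this (rung-level, RECORD label).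
-/

set_option autoImplicit false

noncomputable section

open Literature.MathematicalPhysics.QuantumFieldTheory
open Summit.QuantumFields.YangMills.Theorems.WeakCouplingRates
open Summit.QuantumFields.YangMills.Theorems.FreeEnergyLogCoefficient (dimE)

namespace Summit.QuantumFields.YangMills.Theorems.ColdBoxAllGroups

/-- **Registered stub `stub_boxDirichletAbsG` (FLAT-ABS-G) of crux `stmt-QuantumFields-22255`**, by name and signature: for every compact simple `G`
with ANY Borel measurable structure and every `r : LatticeRep G`, below a ceiling `θ₀(G,r)` and for `κ > 8θ`, eventually in `β`, for all `T ≤ ⌈β^θ⌉`,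
`|β²·boxPlaqCov r.ρ β ⌈β^θ⌉ T − (dimE r.ρ/4)·boxDirCircSqCov ⌈β^θ⌉ T| ≤ β^{−κ}` — the sibling crux's `stub_boxDirichletDominationAbsG` applied to
`stub_boxLargeFieldRarityG`, transported from `borel G` by `subst`. [folklore] -/
theorem stub_boxDirichletAbsG :
    ∀ (G : Type) [Group G] [TopologicalSpace G] [IsTopologicalGroup G] [CompactSpace G] [MeasurableSpace G] [BorelSpace G],
    IsCompactSimpleLieGroup G → ∀ r : LatticeRep G, ∃ θ₀ : ℝ, 0 < θ₀ ∧ ∀ θ : ℝ, 0 < θ → θ ≤ θ₀ → ∃ κ : ℝ, 8 * θ < κ ∧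
      ∃ β₀ : ℝ, ∀ β : ℝ, β₀ ≤ β → ∀ T : ℕ, T ≤ ⌈β ^ θ⌉₊ →
        |β ^ 2 * boxPlaqCov r.ρ β ⌈β ^ θ⌉₊ T - (dimE r.ρ : ℝ) / 4 * boxDirCircSqCov ⌈β ^ θ⌉₊ T| ≤ β ^ (-κ) := by
  intro G _ _ _ _ mG hBG hG r
  have hm : mG = borel G := @BorelSpace.measurable_eq G _ mG hBG
  subst hm
  letI : MeasurableSpace G := borel G
  exact stub_boxDirichletDominationAbsG stub_boxLargeFieldRarityG G hG r

end Summit.QuantumFields.YangMills.Theorems.ColdBoxAllGroups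

end
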